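import Summits.ResolutionOfSingularities.ResolutionOfSingularities.Theorems.PurelyInseparableDim4ResConeTwoSlotLegality
import Summits.ResolutionOfSingularities.ResolutionOfSingularities.Theorems.PurelyInseparableDim4ResConeCornerWalls
import HarnessLib
import HarnessLib.Audit.Tags

/-!
# Purely inseparable four-folds — TWO-SLOT GAME, FLAG READINGS: after a pure corner step the isolation of the
# child lights one of six frame coefficients (cell `res-dim4-pi`, K2(p) lane, slice B brick K24a, part β6)

[OURS · counted 0 · cell `res-dim4-pi` · K2(p) lane (holder res-dim4-p-12 g3, «p-1 takes K24a» 2026-08-29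
01:14Z; statement layer 01:24Z, stub β6); spec = res-dim4-idea-4 g3's FLAG list (bus 00:38:54Z) · seat
res-dim4-p-1 g3.]  Nothing here proves K2(p)/K2(5), `NoIsolatedTrap p p` or resolution of singularities in
dimension ≥ 4 / characteristic `p`.  AI kernel work, weaker than expert review.

SETTING (`p = 5`, `d = 3`, as in `…ResConeTwoSlotLegality`): a framed state `s̃` with boundary `r = e_κ + e_o + e_ν`,
`x^r ∣ F̃`, `ord₀ F̃ = 6`, free letter `f`, whose residual cone is `a·x_f³` (`hcone`: no other degree-`3` residual
monomial) and whose residual is divisible by `x_κ` up to `u`-degree `1` and total degree `5` (`hdivκ` — the slot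
letter `κ` divides `A₀` and `A₁` in the pair presentation; β3's output); the PURE CORNER child in chart `κ` is
ISOLATED, keeps `ord₀ = 6`, and is again straight in the transported frame (`hcone'`, β5's output).

* §1 exponent bookkeeping on four named letters (`eq_sum_single_four`, `degree_eq_four`, `quad_apply`,
  `apply_add_le_degIn_erase`).
* §2 **`flag_readings_of_corner`** — then one of the six child coefficients at
  `r + {e_κ+3e_o, 2e_κ+2e_o, e_κ+2e_o+e_ν, 2e_κ+3e_o, 2e_κ+4e_o, e_f+e_κ+2e_o}` is non-zero (idea-4's FLAG after a
  `κ`-step: `S₀′ ∋ x_o², x_κx_o, x_ox_ν, x_κx_o², x_κx_o³` or `S₁′ ∋ x_o`; α's `hflag`).  Route: isolation ⇒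
  `ord_{(o)} F̃′ < 5` (p-5's `ordAlong_erase_lt_of_isIsolated`) ⇒ a child monomial `x^{E}` with
  `E_κ + E_ν + E_f ≤ 4`; no births backward (p-7's `exists_of_mem_support_step_zero`) ⇒ `E` is the chart image
  `r + m.update κ (|m| − 3)` of a parent residual monomial `x^{r+m}`; the parent's cone / `x_κ`-divisibility and
  the child's order / cone leave exactly the six exponents.

[cite: CossartJannsenSaito2020, Thm. 3.14] [cite: HauserPerlega2019PRIMS, §2 (the blowup in the x₁-chart)]
bears_on: LADDER-RESOLUTION:D157-DOOR2 (res-dim4-pi · K2(p) · slice B · K24a-β6).  Supports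
stmt-ResolutionOfSingularities-16155 (helper).
-/

set_option linter.dupNamespace false -- mandated namespace of this single-conjunct summit

noncomputable section

namespace Summit.ResolutionOfSingularities.ResolutionOfSingularities.Theorems.PIDim4

namespace ResCone

open MvPolynomial Finset
open Literature.AlgebraicGeometry.Resolution
open Literature.AlgebraicGeometry.Resolution.CentreBlowup
open Literature.AlgebraicGeometry.Resolution.Hauser2010
open Literature.AlgebraicGeometry.Resolution.HauserPerlega2019

variable {K : Type} [Field K]

/-! ## 1. Exponents on four named letters -/

/-- A finitely supported function on four pairwise distinct letters exhausting `Fin 4` is the sum of its four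
singles. [folklore] -/
theorem eq_sum_single_four {κ o ν f : Fin 4} (hκo : κ ≠ o) (hκν : κ ≠ ν) (hκf : κ ≠ f) (hoν : o ≠ ν)
    (hof : o ≠ f) (hνf : ν ≠ f) (m : Fin 4 →₀ ℕ) :
    m = Finsupp.single κ (m κ) + Finsupp.single o (m o) + Finsupp.single ν (m ν) + Finsupp.single f (m f) := by
  ext k
  rcases letters_exhaust hκo hκν hκf hoν hof hνf k with rfl | rfl | rfl | rfl
  · simp [hκo.symm, hκν.symm, hκf.symm]
  · simp [hκo, hoν.symm, hof.symm]
  · simp [hκν, hoν, hνf.symm]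
  · simp [hκf, hof, hνf]

/-- Coordinates of a four-single sum. [folklore] -/
theorem quad_apply {κ o ν f : Fin 4} (hκo : κ ≠ o) (hκν : κ ≠ ν) (hκf : κ ≠ f) (hoν : o ≠ ν)
    (hof : o ≠ f) (hνf : ν ≠ f) (a b c d : ℕ) :
    (Finsupp.single κ a + Finsupp.single o b + Finsupp.single ν c + Finsupp.single f d : Fin 4 →₀ ℕ) κ = a ∧
      (Finsupp.single κ a + Finsupp.single o b + Finsupp.single ν c + Finsupp.single f d : Fin 4 →₀ ℕ) o = b ∧
      (Finsupp.single κ a + Finsupp.single o b + Finsupp.single ν c + Finsupp.single f d : Fin 4 →₀ ℕ) ν = c ∧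
      (Finsupp.single κ a + Finsupp.single o b + Finsupp.single ν c + Finsupp.single f d : Fin 4 →₀ ℕ) f = d := by
  refine ⟨?_, ?_, ?_, ?_⟩
  · simp [hκo.symm, hκν.symm, hκf.symm]
  · simp [hκo, hoν.symm, hof.symm]
  · simp [hκν, hoν, hνf.symm]
  · simp [hκf, hof, hνf]

/-- The degree of a four-single sum. [folklore] -/
theorem degree_quad (κ o ν f : Fin 4) (a b c d : ℕ) :
    (Finsupp.single κ a + Finsupp.single o b + Finsupp.single ν c + Finsupp.single f d : Fin 4 →₀ ℕ).degree =
      a + b + c + d := by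
  rw [map_add, map_add, map_add, Finsupp.degree_single, Finsupp.degree_single, Finsupp.degree_single,
    Finsupp.degree_single]

/-- Sum of two four-single sums. [folklore] -/
theorem quad_add_quad (κ o ν f : Fin 4) (a b c d a' b' c' d' : ℕ) :
    (Finsupp.single κ a + Finsupp.single o b + Finsupp.single ν c + Finsupp.single f d : Fin 4 →₀ ℕ) +
        (Finsupp.single κ a' + Finsupp.single o b' + Finsupp.single ν c' + Finsupp.single f d') =
      Finsupp.single κ (a + a') + Finsupp.single o (b + b') + Finsupp.single ν (c + c') +
        Finsupp.single f (d + d') := by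
  rw [Finsupp.single_add, Finsupp.single_add, Finsupp.single_add, Finsupp.single_add]
  abel

/-- `E_κ + E_ν + E_f ≤ deg_{(o)} E` (the three letters lie in `univ ∖ {o}`). [folklore] -/
theorem apply_add_le_degIn_erase {κ o ν f : Fin 4} (hκo : κ ≠ o) (hκν : κ ≠ ν) (hκf : κ ≠ f) (hoν : o ≠ ν)
    (hof : o ≠ f) (hνf : ν ≠ f) (E : Fin 4 →₀ ℕ) :
    E κ + E ν + E f ≤ degIn (Finset.univ.erase o) E := by
  unfold degIn
  have hsub : ({κ, ν, f} : Finset (Fin 4)) ⊆ Finset.univ.erase o := by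
    intro i hi
    simp only [Finset.mem_insert, Finset.mem_singleton] at hi
    rw [Finset.mem_erase]
    refine ⟨?_, Finset.mem_univ i⟩
    rcases hi with rfl | rfl | rfl
    exacts [hκo, hoν.symm, hof.symm]
  have h := Finset.sum_le_sum_of_subset (f := fun i => E i) hsub
  have hsum : ∑ i ∈ ({κ, ν, f} : Finset (Fin 4)), E i = E κ + E ν + E f := by
    rw [Finset.sum_insert (by simp [hκν, hκf]), Finset.sum_insert (by simp [hνf]), Finset.sum_singleton,
      add_assoc]
  rw [hsum] at h
  exact h

/-! ## 2. The flag after a pure corner step -/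

section Flag

variable [DecidableEq K]

/-- **THE FLAG AFTER A PURE CORNER STEP** (K24a-β6).  `p = 5` (any field: the statement is exponent
combinatorics of the corner map and the isolation wall); framed state with boundary `r = e_κ + e_o + e_ν`
(weights `1`), `x^r ∣ F̃`, `ord₀ F̃ = 6`, residual cone `a·x_f³` (`hcone`), residual divisible by the slot letter
`x_κ` up to `u`-degree `1` / total degree `5` (`hdivκ`); if the pure corner child in chart `κ` is ISOLATED with
`ord₀ = 6` and straight in the transported frame (`hcone'`), then one of the six child coefficients at
`r + (e_κ+3e_o)`, `r + (2e_κ+2e_o)`, `r + (e_κ+2e_o+e_ν)`, `r + (2e_κ+3e_o)`, `r + (2e_κ+4e_o)`, `r + (e_f+e_κ+2e_o)` is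
non-zero — α's `hflag` (`S₀′ ∋ x_o², x_κx_o, x_ox_ν, x_κx_o², x_κx_o³` or `S₁′ ∋ x_o`). [OURS · idea-4's FLAG]
[cite: CossartJannsenSaito2020, Thm. 3.14] -/
theorem flag_readings_of_corner {κ o ν f : Fin 4} (hκo : κ ≠ o) (hκν : κ ≠ ν) (hκf : κ ≠ f) (hoν : o ≠ ν)
    (hof : o ≠ f) (hνf : ν ≠ f) {s : State K}
    (hr : s.r = Finsupp.single κ 1 + Finsupp.single o 1 + Finsupp.single ν 1)
    (hdiv : ∀ e ∈ s.F.support, s.r ≤ e) (ho : ordZero s.F = (6 : ℕ))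
    (hcone : ∀ m : Fin 4 →₀ ℕ, m.degree = 3 → m ≠ Finsupp.single f 3 → coeff (s.r + m) s.F = 0)
    (hdivκ : ∀ m : Fin 4 →₀ ℕ, m κ = 0 → m f ≤ 1 → m.degree ≤ 5 → coeff (s.r + m) s.F = 0)
    (hiso' : IsIsolated 5 (CentreBlowup.step 5 Finset.univ κ 0 s).F)
    (ho' : ordZero (CentreBlowup.step 5 Finset.univ κ 0 s).F = (6 : ℕ))
    (hcone' : ∀ m : Fin 4 →₀ ℕ, m.degree = 3 → m ≠ Finsupp.single f 3 →
      coeff (s.r + m) (CentreBlowup.step 5 Finset.univ κ 0 s).F = 0) :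
    coeff (s.r + (Finsupp.single κ 1 + Finsupp.single o 3)) (CentreBlowup.step 5 Finset.univ κ 0 s).F ≠ 0 ∨
      coeff (s.r + (Finsupp.single κ 2 + Finsupp.single o 2)) (CentreBlowup.step 5 Finset.univ κ 0 s).F ≠ 0 ∨
      coeff (s.r + (Finsupp.single κ 1 + Finsupp.single o 2 + Finsupp.single ν 1))
          (CentreBlowup.step 5 Finset.univ κ 0 s).F ≠ 0 ∨
      coeff (s.r + (Finsupp.single κ 2 + Finsupp.single o 3)) (CentreBlowup.step 5 Finset.univ κ 0 s).F ≠ 0 ∨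
      coeff (s.r + (Finsupp.single κ 2 + Finsupp.single o 4)) (CentreBlowup.step 5 Finset.univ κ 0 s).F ≠ 0 ∨
      coeff (s.r + (Finsupp.single f 1 + Finsupp.single κ 1 + Finsupp.single o 2))
          (CentreBlowup.step 5 Finset.univ κ 0 s).F ≠ 0 := by
  set s' := CentreBlowup.step 5 Finset.univ κ 0 s with hs'
  have hrdeg : s.r.degree = 3 := by rw [hr, map_add, map_add]; simp
  have hr4 : s.r = Finsupp.single κ 1 + Finsupp.single o 1 + Finsupp.single ν 1 + Finsupp.single f 0 := by
    rw [hr, Finsupp.single_zero, add_zero]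
  -- an isolation witness of the child and its parent source
  obtain ⟨E, hE, hdegE⟩ := exists_degIn_lt_of_ordAlong_lt (ordAlong_erase_lt_of_isIsolated hiso' o)
  obtain ⟨e, he, heE⟩ := exists_of_mem_support_step_zero κ s hE
  obtain ⟨m, rfl⟩ : ∃ m, e = s.r + m := ⟨e - s.r, (add_tsub_cancel_of_le (hdiv e he)).symm⟩
  have h6 := le_degree_of_mem_support_of_ordZero ho he
  rw [map_add, hrdeg] at h6
  have h3m : 3 ≤ m.degree := by omega
  -- coordinates `(a, b, c, d)` of the parent residual exponent and `t = |m| - 3`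
  have hm4 := eq_sum_single_four hκo hκν hκf hoν hof hνf m
  have hmdeg : m.degree = m κ + m o + m ν + m f := by
    conv_lhs => rw [hm4]
    exact degree_quad κ o ν f _ _ _ _
  have hm' : m.update κ (m.degree - 3) = Finsupp.single κ (m.degree - 3) + Finsupp.single o (m o) +
      Finsupp.single ν (m ν) + Finsupp.single f (m f) := by
    ext k
    rcases letters_exhaust hκo hκν hκf hoν hof hνf k with rfl | rfl | rfl | rfl
    · simp [hκo.symm, hκν.symm, hκf.symm]
    · simp [Function.update_of_ne hκo.symm, hκo, hoν.symm, hof.symm]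
    · simp [Function.update_of_ne hκν.symm, hκν, hoν, hνf.symm]
    · simp [Function.update_of_ne hκf.symm, hκf, hof, hνf]
  have hE' : E = Finsupp.single κ (1 + (m.degree - 3)) + Finsupp.single o (1 + m o) +
      Finsupp.single ν (1 + m ν) + Finsupp.single f (0 + m f) := by
    rw [← heE, chartExponent_boundary_add hκo hκν hr h3m, hm', hr4, quad_add_quad]
  have hq := quad_apply hκo hκν hκf hoν hof hνf (1 + (m.degree - 3)) (1 + m o) (1 + m ν) (0 + m f)
  -- the isolation inequality `E_κ + E_ν + E_f ≤ 4`
  have hineq : (1 + (m.degree - 3)) + (1 + m ν) + (0 + m f) < 5 := by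
    have h := lt_of_le_of_lt (apply_add_le_degIn_erase hκo hκν hκf hoν hof hνf E) hdegE
    rw [hE', hq.1, hq.2.2.1, hq.2.2.2] at h
    exact h
  -- the parent coefficient is non-zero, the child coefficient is non-zero
  have hpar : coeff (s.r + m) s.F ≠ 0 := MvPolynomial.mem_support_iff.mp he
  have hchi : coeff E s'.F ≠ 0 := MvPolynomial.mem_support_iff.mp hE
  -- parent exclusions
  have hP1 : ¬ (m κ = 0 ∧ m f ≤ 1 ∧ m.degree ≤ 5) := fun h => hpar (hdivκ m h.1 h.2.1 h.2.2)
  have hP2 : ¬ (m.degree = 3 ∧ m f ≠ 3) := fun h => hpar (hcone m h.1 fun heq => h.2 (by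
    rw [heq, Finsupp.single_eq_same]))
  -- child exclusions
  have hEdeg : E.degree = 3 + (m.degree - 3) + m o + m ν + m f := by
    rw [hE', degree_quad]; ring
  have hC1 : ¬ (3 + (m.degree - 3) + m o + m ν + m f < 6) := fun h =>
    hchi (coeff_eq_zero_of_degree_lt_ordZero (by rw [ho', hEdeg]; exact_mod_cast h))
  have hEr : E = s.r + (Finsupp.single κ (m.degree - 3) + Finsupp.single o (m o) + Finsupp.single ν (m ν) +
      Finsupp.single f (m f)) := by
    rw [hE', hr4, quad_add_quad]
  have hC2 : ¬ ((m.degree - 3) + m o + m ν + m f = 3 ∧ m f ≠ 3) := fun h => hchi (by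
    rw [hEr]
    refine hcone' _ (by rw [degree_quad]; exact h.1) fun heq => h.2 ?_
    have := (quad_apply hκo hκν hκf hoν hof hνf (m.degree - 3) (m o) (m ν) (m f)).2.2.2
    rw [heq, Finsupp.single_eq_same] at this
    exact this.symm)
  -- the six survivors, by a small case analysis on `(t, c, d) = (|m| - 3, m_ν, m_f)` and then `b = m_o`
  have ht12 : m.degree - 3 = 1 ∨ m.degree - 3 = 2 := by omega
  have hd1 : m f ≤ 1 := by omega
  have ha1 : 1 ≤ m κ := by
    by_contra h
    exact hP1 ⟨by omega, hd1, by omega⟩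
  rw [hEr] at hchi
  rcases ht12 with ht | ht
  · have hcd : (m ν = 0 ∧ m f = 0) ∨ (m ν = 1 ∧ m f = 0) ∨ (m ν = 0 ∧ m f = 1) := by omega
    rcases hcd with ⟨hc, hd⟩ | ⟨hc, hd⟩ | ⟨hc, hd⟩
    · have hb : m o = 3 := by omega
      refine Or.inl ?_
      rw [ht, hb, hc, hd] at hchi
      simpa [Finsupp.single_zero] using hchi
    · have hb : m o = 2 := by omega
      refine Or.inr (Or.inr (Or.inl ?_))
      rw [ht, hb, hc, hd] at hchi
      simpa [Finsupp.single_zero] using hchi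
    · have hb : m o = 2 := by omega
      refine Or.inr (Or.inr (Or.inr (Or.inr (Or.inr ?_))))
      rw [ht, hb, hc, hd] at hchi
      have hx : Finsupp.single κ 1 + Finsupp.single o 2 + Finsupp.single ν 0 + Finsupp.single f 1 =
          (Finsupp.single f 1 + Finsupp.single κ 1 + Finsupp.single o 2 : Fin 4 →₀ ℕ) := by
        rw [Finsupp.single_zero, add_zero]
        abel
      rw [hx] at hchi
      exact hchi
  · have hc : m ν = 0 := by omega
    have hd : m f = 0 := by omega
    have hb : m o = 2 ∨ m o = 3 ∨ m o = 4 := by omega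
    rcases hb with hb | hb | hb
    · refine Or.inr (Or.inl ?_)
      rw [ht, hb, hc, hd] at hchi
      simpa [Finsupp.single_zero] using hchi
    · refine Or.inr (Or.inr (Or.inr (Or.inl ?_)))
      rw [ht, hb, hc, hd] at hchi
      simpa [Finsupp.single_zero] using hchi
    · refine Or.inr (Or.inr (Or.inr (Or.inr (Or.inl ?_))))
      rw [ht, hb, hc, hd] at hchi
      simpa [Finsupp.single_zero] using hchi

end Flag

end ResCone

end Summit.ResolutionOfSingularities.ResolutionOfSingularities.Theorems.PIDim4

end
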